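import Mathlib
import Summits.Ventures.PercRepro2.CoinScope

/-!
# Directed BHK under a BACKWARD CONTAINMENT fails at an OR-vertex of a closed-out pendant
sub-head — a kernel-checked witness (blind cell PercRepro2, night-2 g6; proofs/NIGHT2-DARC.md §28)

NIGHT2-DARC.md (27.11) conjectured, for `v` inside a closed-out pendant sub-head of single-arc
coins, `Cov(X, Y | s ↛ T′, v ∈ K⁻) ≥ 0` (`X = 1[a ∈ S⁺]`, `Y = 1[b ∈ S⁺]`) — the layer fact the
tilt step of the lsm-head method needs at a vertex of out-degree `≥ 2`.  This file records with
`decide +kernel` (standard axioms only) that it is FALSE on the smallest OR-vertex sub-head, and that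
the weaker «source-arc pivotal functional» `Φ_R(R ∩ {v ∈ K⁻}) ≥ 0` (= row 2′DARC-dual for the arc
`s → v`) fails with it:

* seven vertices `s = 0, a = 1, b = 2, v = 3, v₁ = 4, v₂ = 5, t = 6`; four fair coins
  `s → a`, `s → b`, `v₁ → t`, `v₂ → t` and four sure coins `a → v₁`, `b → v₂`, `v → v₁`, `v → v₂`
  (the sub-head `{v, v₁, v₂}` is closed out into `t`, `v` is an OR-vertex with sure arcs to the two
  pendant leaves, whose entries come from the two markers); `T = {t}`.
* `R = {s ↛ t} = {¬(x ∧ d₁) ∧ ¬(y ∧ d₂)}` (`x, y, d₁, d₂` the four fair coins): `P(R) = 9/16`,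
  `Cov(X, Y | R) = 0` — the BASE row holds with equality.
* `C = R ∩ {v ∈ K⁻} = R ∩ {d₁ ∨ d₂}`: `P(C) = 5/16`, `E[X; C] = E[Y; C] = 1/16`, `E[XY; C] = 0`, so
  `Cov(X, Y | R, v ∈ K⁻) = −1/25 < 0` and `Φ_R(C) = E[(X − m_X)(Y − m_Y); C] = −1/144 < 0`.

All masses are integers in units of `2^{-8}` (`den = 2`, eight coins).  Conventions and the
evaluator (`Coin`, `mass`, `reach`, `mem`) are those of `CoinScope.lean` (night-2 g0).
Consequence (§28): the per-coordinate proof of the tilt lemma (`tilt_single`'s layer fact `hK₁`)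
has no coin-system counterpart at an OR-vertex; the forest theorem's hypothesis is sharp for that
method.
-/

namespace Summit.Ventures.PercRepro2.CoinKContainNeg

open CoinScope

/-- Eight coins on seven vertices: fair `s→a`, `s→b`, `v₁→t`, `v₂→t` (weight `1/2`) and sure
`a→v₁`, `b→v₂`, `v→v₁`, `v→v₂` (weight `2/2`). -/
def coinsC : List Coin :=
  [⟨1, [(0, 1)]⟩, ⟨1, [(0, 2)]⟩, ⟨1, [(4, 6)]⟩, ⟨1, [(5, 6)]⟩,
   ⟨2, [(1, 4)]⟩, ⟨2, [(2, 5)]⟩, ⟨2, [(3, 4)]⟩, ⟨2, [(3, 5)]⟩]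

/-- The root `s = 0`. -/
def sC : Nat := 0
/-- The single target vertex `t = 6`. -/
def tC : Nat := 6
/-- The marker `a = 1`. -/
def aC : Nat := 1
/-- The marker `b = 2`. -/
def bC : Nat := 2
/-- The OR-vertex `v = 3` of the sub-head `{v, v₁ = 4, v₂ = 5}`. -/
def vC : Nat := 3

/-- `R = {s ↛ t}`. -/
def RC (c : Nat) : Bool := !(mem (reach coinsC 7 c sC) tC)
/-- `X = 1[a ∈ S⁺]`. -/
def XC (c : Nat) : Bool := mem (reach coinsC 7 c sC) aC
/-- `Y = 1[b ∈ S⁺]`. -/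
def YC (c : Nat) : Bool := mem (reach coinsC 7 c sC) bC
/-- `C = R ∩ {v ∈ K⁻} = R ∩ {v ⇝ t}`: the backward containment inside `R`. -/
def CC (c : Nat) : Bool := RC c && mem (reach coinsC 7 c vC) tC

/-- `2^8 · P(R) = 144`. -/
theorem massC_R : mass coinsC 2 RC = 144 := by decide +kernel
/-- `2^8 · E[X; R] = 48`. -/
theorem massC_XR : mass coinsC 2 (fun c => RC c && XC c) = 48 := by decide +kernel
/-- `2^8 · E[Y; R] = 48`. -/
theorem massC_YR : mass coinsC 2 (fun c => RC c && YC c) = 48 := by decide +kernel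
/-- `2^8 · E[XY; R] = 16`. -/
theorem massC_XYR : mass coinsC 2 (fun c => RC c && XC c && YC c) = 16 := by decide +kernel
/-- `2^8 · P(R ∩ {v ∈ K⁻}) = 80`. -/
theorem massC_C : mass coinsC 2 CC = 80 := by decide +kernel
/-- `2^8 · E[X; R ∩ {v ∈ K⁻}] = 16`. -/
theorem massC_XC : mass coinsC 2 (fun c => CC c && XC c) = 16 := by decide +kernel
/-- `2^8 · E[Y; R ∩ {v ∈ K⁻}] = 16`. -/
theorem massC_YC : mass coinsC 2 (fun c => CC c && YC c) = 16 := by decide +kernel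
/-- `2^8 · E[XY; R ∩ {v ∈ K⁻}] = 0`. -/
theorem massC_XYC : mass coinsC 2 (fun c => CC c && XC c && YC c) = 0 := by decide +kernel

/-- The BASE row holds with equality on the witness: `Cov(X, Y | s ↛ t) = 0`. -/
theorem base_holds_C :
    ((mass coinsC 2 (fun c => RC c && XC c && YC c) : ℚ) / mass coinsC 2 RC)
      - (mass coinsC 2 (fun c => RC c && XC c) / mass coinsC 2 RC)
        * (mass coinsC 2 (fun c => RC c && YC c) / mass coinsC 2 RC) = 0 := by
  rw [massC_R, massC_XR, massC_YR, massC_XYR]; norm_num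

/-- The containment event is not degenerate: `P(R ∩ {v ∈ K⁻}) = 5/16`. -/
theorem probC_C : (mass coinsC 2 CC : ℚ) / 2 ^ 8 = 5 / 16 := by
  rw [massC_C]; norm_num

/-- **CONJECTURE (27.11) FAILS**: `Cov(X, Y | s ↛ t, v ∈ K⁻) = −1/25 < 0` for the OR-vertex `v` of
a closed-out pendant sub-head of single-arc coins. -/
theorem kcontain_bhk_fails :
    ((mass coinsC 2 (fun c => CC c && XC c && YC c) : ℚ) / mass coinsC 2 CC)
      - (mass coinsC 2 (fun c => CC c && XC c) / mass coinsC 2 CC)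
        * (mass coinsC 2 (fun c => CC c && YC c) / mass coinsC 2 CC) = -1 / 25 := by
  rw [massC_C, massC_XC, massC_YC, massC_XYC]; norm_num

/-- **The source-arc pivotal functional is NEGATIVE**: with `m = E[· | R]`,
`Φ_R(R ∩ {v ∈ K⁻}) = E[(X − m_X)(Y − m_Y); R ∩ {v ∈ K⁻}] = −1/144 < 0` (so the K-containment
analogue of Lemma A′ fails, and `Φ_R(R ∩ {v ∉ K⁻}) = Φ_R(R) + 1/144 > Φ_R(R)`). -/
theorem kcontain_phi_fails :
    let PR : ℚ := mass coinsC 2 RC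
    let mX : ℚ := mass coinsC 2 (fun c => RC c && XC c) / PR
    let mY : ℚ := mass coinsC 2 (fun c => RC c && YC c) / PR
    (mass coinsC 2 (fun c => CC c && XC c && YC c) - mX * mass coinsC 2 (fun c => CC c && YC c)
      - mY * mass coinsC 2 (fun c => CC c && XC c) + mX * mY * mass coinsC 2 CC) / 2 ^ 8
      = -1 / 144 := by
  intro PR mX mY
  simp only [PR, mX, mY]
  rw [massC_R, massC_XR, massC_YR, massC_C, massC_XC, massC_YC, massC_XYC]; norm_num

end Summit.Ventures.PercRepro2.CoinKContainNeg
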